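import Summits.QuantumFields.YangMills.Theorems.VirialFluxGapRadialProfile
import Summits.QuantumFields.YangMills.Theorems.VirialFluxGapCentralProjectionDefs
import HarnessLib

/-!
# Route `VirialFluxGap` (YangMills): the ANCHORED radial profile `Im(c·q)` per variable — frame derivatives and the EXACT per-variable divergence `3·Re(c·q)`
# (brick (1) of the explicit central field `X_c = X_z + U` for crux ⟨stmt-QuantumFields-24141⟩ `PeriodicSoftness`; free-hands helper)

Width seat `ym-line-sfw-p2-w3` g59 (cell ym-idea-1, free hands; own crux ⟨22884⟩ has no free stub), `--supports stmt-QuantumFields-24141`.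

w3 g58's ✓`VirialFluxGapRadialProfile` treats the profile `Im_a(q(P_v))` of a variable (anchor `1`).  The transverse half `U` of the explicit central field
proposed in HOME memo `w3-g59-EXPLICIT-CENTRAL-FIELD-24141.md` (evidence on ⟨24141⟩) is the profile RE-ANCHORED at the slot of the central projection:
direction `quatMatrix(Im(conj(c_v)·q(P_v)))` at the variable `v`, `c_v = liftQuat σ_B z_B` (✓`centralRep`) on the wrap blocks ∕ seam, `c_v = 1` elsewhere.  For a
FROZEN anchor `c ∈ ℍ` the anchored profile `M ↦ Im_a(c·q(M_v))` is again a real-LINEAR functional of the coordinates, so the calculus of the radial profile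
goes through verbatim:

* §1 quaternion bookkeeping: `readQuat_quatMatrix`, ★ `anchored_units_sum` (`Σ_a Im_a(c·q·e_a) = 3·Re(c·q)`, ✓`im_mul_units_sum` at `c·q`),
  `re_mul_le_of_norm` (`Re(c·q) ≤ 1` for unit `c, q`), ★ `im_star_liftQuat_mul_centralRep` (the anchored profile VANISHES at the anchor's own slot: `U = 0` on the
  comb-constant family);
* §2 `exists_slice_anchored_clm` ∕ `exists_seam_anchored_clm` — the three anchored functionals of a variable as continuous linear maps, and their values on
  `ringCoord P` (`slice_anchored_ringCoord`, `seam_anchored_ringCoord`);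
* §3 ★★ `slice_anchored_frameDeriv` ∕ `seam_anchored_frameDeriv` — along `(v, quatMatrix p)` the derivative of `Im_a(c·q(P_v))` is `Im_a(c·q(P_v)·p)`; other
  variables are transparent (`…_of_ne`, `…_seam`, `seam_anchored_frameDeriv_of_ne`);
* §4 ★★★ `slice_anchored_div` ∕ `seam_anchored_div` — the per-variable Haar divergence of the anchored profile is `3·Re(c·q(P_v))` EXACTLY, `≤ 3` and `|·| ≤ 3`
  for a unit anchor (`anchored_div_le`, `abs_anchored_div_le`): the (E2) half «`div U ≤ #ι`» of the explicit central field, anchor frozen.  The dependence of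
  the anchor on `P` through the block averages (the «base motion», `−3` per block) is the next brick.

HONEST LABEL: linear-algebra bookkeeping for a RECORD-label crux of a DRAFT route; no coefficient field is assembled and neither pointwise inequality of the
Euler field is proved here; ⟨24141⟩ and ⟨22884⟩ stay OPEN; the Yang–Mills mass gap is NOT proved by this; no summit is proved by a line.  THEOREMS ONLY
(no `def`, no `sorry`).

References: [cite: arXiv220412737, §2 (2.4) (p. 10)]; [cite: CosteEtAl1985]; [cite: Luscher1983, §2].
-/

set_option autoImplicit false

noncomputable section

open scoped Matrix BigOperators ContDiff Topology Quaternion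
open Literature.MathematicalPhysics.QuantumFieldTheory hiding SU2
open Literature.MathematicalPhysics.QuantumLattice
open Literature.MathematicalPhysics.QuantumFieldTheory.SUNBakryEmery (matTop)
open Summit.QuantumFields.YangMills.Theorems.FemtoTransferGap

namespace Summit.QuantumFields.YangMills.Theorems.VirialFluxGap.FrameDerivative

variable {L : ℕ} [NeZero L]

open scoped Matrix.Norms.Frobenius

attribute [local instance 2000] Literature.MathematicalPhysics.QuantumFieldTheory.SUNBakryEmery.matTop

/-! ## §1 Quaternion bookkeeping -/

section Quat

omit [NeZero L]

/-- Reading the first row of `quatMatrix r` gives back `r`. [folklore] -/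
theorem readQuat_quatMatrix (r : ℍ) :
    (⟨((quatMatrix r) 0 0).re, ((quatMatrix r) 0 0).im, ((quatMatrix r) 0 1).re, ((quatMatrix r) 0 1).im⟩ : ℍ) = r := by
  ext <;> simp

/-- Reading the first row of the zero matrix gives `0`. [folklore] -/
theorem readQuat_zero :
    (⟨((0 : Matrix (Fin 2) (Fin 2) ℂ) 0 0).re, ((0 : Matrix (Fin 2) (Fin 2) ℂ) 0 0).im, ((0 : Matrix (Fin 2) (Fin 2) ℂ) 0 1).re,
      ((0 : Matrix (Fin 2) (Fin 2) ℂ) 0 1).im⟩ : ℍ) = 0 := by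
  ext <;> simp

/-- ★ **Anchored trace over the quaternion units**: `Im₁(c·q·i) + Im₂(c·q·j) + Im₃(c·q·k) = 3·Re(c·q)`. [folklore] -/
theorem anchored_units_sum (c q : ℍ) :
    (c * (q * ⟨0, 1, 0, 0⟩)).imI + (c * (q * ⟨0, 0, 1, 0⟩)).imJ + (c * (q * ⟨0, 0, 0, 1⟩)).imK = 3 * (c * q).re := by
  rw [← mul_assoc, ← mul_assoc, ← mul_assoc]
  exact im_mul_units_sum _

/-- For unit `c, q`: `Re(c·q) ≤ 1` and `|Re(c·q)| ≤ 1`. [folklore] -/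
theorem re_mul_le_of_norm {c q : ℍ} (hc : ‖c‖ = 1) (hq : ‖q‖ = 1) : |(c * q).re| ≤ 1 ∧ (c * q).re ≤ 1 := by
  have h := abs_re_le_norm (c * q)
  rw [norm_mul, hc, hq, mul_one] at h
  exact ⟨h, (le_abs_self _).trans h⟩

/-- The conjugate of the central lift is a unit quaternion. [folklore] -/
theorem norm_star_liftQuat {σ : ℝ} (hσ : σ ^ 2 = 1) {z : Fin 3 → ℝ} (hz : (z 0) ^ 2 + (z 1) ^ 2 + (z 2) ^ 2 ≤ 1) :
    ‖star (liftQuat σ z)‖ = 1 := by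
  rw [norm_star]; exact norm_liftQuat hσ hz

/-- ★ **The anchored profile vanishes at the anchor's own slot**: `Im(conj(lift σ z)·q(centralRep σ z)) = 0` — on the comb-constant family the
transverse field `U` is zero. [cite: CosteEtAl1985] -/
theorem im_star_liftQuat_mul_centralRep {σ : ℝ} (hσ : σ ^ 2 = 1) {z : Fin 3 → ℝ} (hz : (z 0) ^ 2 + (z 1) ^ 2 + (z 2) ^ 2 ≤ 1) :
    (star (liftQuat σ z) * su2Quat (centralRep σ z)).imI = 0 ∧ (star (liftQuat σ z) * su2Quat (centralRep σ z)).imJ = 0 ∧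
      (star (liftQuat σ z) * su2Quat (centralRep σ z)).imK = 0 := by
  rw [su2Quat_centralRep hσ hz, Quaternion.star_mul_self]
  exact ⟨rfl, rfl, rfl⟩

end Quat

/-! ## §2 The anchored functionals are continuous linear -/

/-- The three ANCHORED profile functionals of the slice variable `(i,e)` with frozen anchor `c`: `M ↦ Im_a(c·q(M_{i,e}))`, real-linear in the
coordinates. [folklore] -/
theorem exists_slice_anchored_clm (c : ℍ) (i : Fin (2 * L - 1 + 1)) (e : Edge 3 L) :
    ∃ ℓ₁ ℓ₂ ℓ₃ : ((Fin (2 * L - 1 + 1) → Edge 3 L → Matrix (Fin 2) (Fin 2) ℂ) × (Site 3 L → Matrix (Fin 2) (Fin 2) ℂ)) →L[ℝ] ℝ,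
      (∀ M, ℓ₁ M = (c * ⟨((M.1 i e) 0 0).re, ((M.1 i e) 0 0).im, ((M.1 i e) 0 1).re, ((M.1 i e) 0 1).im⟩).imI) ∧
      (∀ M, ℓ₂ M = (c * ⟨((M.1 i e) 0 0).re, ((M.1 i e) 0 0).im, ((M.1 i e) 0 1).re, ((M.1 i e) 0 1).im⟩).imJ) ∧
      (∀ M, ℓ₃ M = (c * ⟨((M.1 i e) 0 0).re, ((M.1 i e) 0 0).im, ((M.1 i e) 0 1).re, ((M.1 i e) 0 1).im⟩).imK) := by
  refine ⟨LinearMap.toContinuousLinearMap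
      { toFun := fun M => (c * ⟨((M.1 i e) 0 0).re, ((M.1 i e) 0 0).im, ((M.1 i e) 0 1).re, ((M.1 i e) 0 1).im⟩).imI,
        map_add' := fun M N => by simp only [Prod.fst_add, Pi.add_apply, Matrix.add_apply, Complex.add_re, Complex.add_im, Quaternion.imI_mul]; ring,
        map_smul' := fun r M => by
          simp only [Prod.smul_fst, Pi.smul_apply, Matrix.smul_apply, Complex.real_smul, Complex.mul_re, Complex.mul_im, Complex.ofReal_re,
            Complex.ofReal_im, Quaternion.imI_mul, RingHom.id_apply, smul_eq_mul]; ring },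
    LinearMap.toContinuousLinearMap
      { toFun := fun M => (c * ⟨((M.1 i e) 0 0).re, ((M.1 i e) 0 0).im, ((M.1 i e) 0 1).re, ((M.1 i e) 0 1).im⟩).imJ,
        map_add' := fun M N => by simp only [Prod.fst_add, Pi.add_apply, Matrix.add_apply, Complex.add_re, Complex.add_im, Quaternion.imJ_mul]; ring,
        map_smul' := fun r M => by
          simp only [Prod.smul_fst, Pi.smul_apply, Matrix.smul_apply, Complex.real_smul, Complex.mul_re, Complex.mul_im, Complex.ofReal_re,
            Complex.ofReal_im, Quaternion.imJ_mul, RingHom.id_apply, smul_eq_mul]; ring },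
    LinearMap.toContinuousLinearMap
      { toFun := fun M => (c * ⟨((M.1 i e) 0 0).re, ((M.1 i e) 0 0).im, ((M.1 i e) 0 1).re, ((M.1 i e) 0 1).im⟩).imK,
        map_add' := fun M N => by simp only [Prod.fst_add, Pi.add_apply, Matrix.add_apply, Complex.add_re, Complex.add_im, Quaternion.imK_mul]; ring,
        map_smul' := fun r M => by
          simp only [Prod.smul_fst, Pi.smul_apply, Matrix.smul_apply, Complex.real_smul, Complex.mul_re, Complex.mul_im, Complex.ofReal_re,
            Complex.ofReal_im, Quaternion.imK_mul, RingHom.id_apply, smul_eq_mul]; ring },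
    fun M => rfl, fun M => rfl, fun M => rfl⟩

/-- The three anchored profile functionals of the seam variable `x` with frozen anchor `c`. [folklore] -/
theorem exists_seam_anchored_clm (c : ℍ) (x : Site 3 L) :
    ∃ ℓ₁ ℓ₂ ℓ₃ : ((Fin (2 * L - 1 + 1) → Edge 3 L → Matrix (Fin 2) (Fin 2) ℂ) × (Site 3 L → Matrix (Fin 2) (Fin 2) ℂ)) →L[ℝ] ℝ,
      (∀ M, ℓ₁ M = (c * ⟨((M.2 x) 0 0).re, ((M.2 x) 0 0).im, ((M.2 x) 0 1).re, ((M.2 x) 0 1).im⟩).imI) ∧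
      (∀ M, ℓ₂ M = (c * ⟨((M.2 x) 0 0).re, ((M.2 x) 0 0).im, ((M.2 x) 0 1).re, ((M.2 x) 0 1).im⟩).imJ) ∧
      (∀ M, ℓ₃ M = (c * ⟨((M.2 x) 0 0).re, ((M.2 x) 0 0).im, ((M.2 x) 0 1).re, ((M.2 x) 0 1).im⟩).imK) := by
  refine ⟨LinearMap.toContinuousLinearMap
      { toFun := fun M => (c * ⟨((M.2 x) 0 0).re, ((M.2 x) 0 0).im, ((M.2 x) 0 1).re, ((M.2 x) 0 1).im⟩).imI,
        map_add' := fun M N => by simp only [Prod.snd_add, Pi.add_apply, Matrix.add_apply, Complex.add_re, Complex.add_im, Quaternion.imI_mul]; ring,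
        map_smul' := fun r M => by
          simp only [Prod.smul_snd, Pi.smul_apply, Matrix.smul_apply, Complex.real_smul, Complex.mul_re, Complex.mul_im, Complex.ofReal_re,
            Complex.ofReal_im, Quaternion.imI_mul, RingHom.id_apply, smul_eq_mul]; ring },
    LinearMap.toContinuousLinearMap
      { toFun := fun M => (c * ⟨((M.2 x) 0 0).re, ((M.2 x) 0 0).im, ((M.2 x) 0 1).re, ((M.2 x) 0 1).im⟩).imJ,
        map_add' := fun M N => by simp only [Prod.snd_add, Pi.add_apply, Matrix.add_apply, Complex.add_re, Complex.add_im, Quaternion.imJ_mul]; ring,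
        map_smul' := fun r M => by
          simp only [Prod.smul_snd, Pi.smul_apply, Matrix.smul_apply, Complex.real_smul, Complex.mul_re, Complex.mul_im, Complex.ofReal_re,
            Complex.ofReal_im, Quaternion.imJ_mul, RingHom.id_apply, smul_eq_mul]; ring },
    LinearMap.toContinuousLinearMap
      { toFun := fun M => (c * ⟨((M.2 x) 0 0).re, ((M.2 x) 0 0).im, ((M.2 x) 0 1).re, ((M.2 x) 0 1).im⟩).imK,
        map_add' := fun M N => by simp only [Prod.snd_add, Pi.add_apply, Matrix.add_apply, Complex.add_re, Complex.add_im, Quaternion.imK_mul]; ring,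
        map_smul' := fun r M => by
          simp only [Prod.smul_snd, Pi.smul_apply, Matrix.smul_apply, Complex.real_smul, Complex.mul_re, Complex.mul_im, Complex.ofReal_re,
            Complex.ofReal_im, Quaternion.imK_mul, RingHom.id_apply, smul_eq_mul]; ring },
    fun M => rfl, fun M => rfl, fun M => rfl⟩

/-- On a ring history the quaternion read off the `(i,e)` slot is `su2Quat (P.1 i e)`. [folklore] -/
theorem slice_anchored_ringCoord (i : Fin (2 * L - 1 + 1)) (e : Edge 3 L) (P : (Fin (2 * L - 1 + 1) → GaugeConfig 3 L SU2) × (Site 3 L → SU2)) :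
    (⟨(((ringCoord L P).1 i e) 0 0).re, (((ringCoord L P).1 i e) 0 0).im, (((ringCoord L P).1 i e) 0 1).re, (((ringCoord L P).1 i e) 0 1).im⟩ : ℍ) =
      su2Quat (P.1 i e) := rfl

/-- On a ring history the quaternion read off the seam slot `x` is `su2Quat (P.2 x)`. [folklore] -/
theorem seam_anchored_ringCoord (x : Site 3 L) (P : (Fin (2 * L - 1 + 1) → GaugeConfig 3 L SU2) × (Site 3 L → SU2)) :
    (⟨(((ringCoord L P).2 x) 0 0).re, (((ringCoord L P).2 x) 0 0).im, (((ringCoord L P).2 x) 0 1).re, (((ringCoord L P).2 x) 0 1).im⟩ : ℍ) =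
      su2Quat (P.2 x) := rfl

/-! ## §3 Frame derivatives of the anchored functionals -/

/-- ★★ **Frame derivative of the anchored slice profile along its own variable**: for a continuous linear functional `ℓ` reading `Im_a(c·q(M_{i,e}))`
and a direction `quatMatrix p`, `Dℓ(ringCoord P)[sliceTangent_{(i,e),quatMatrix p} P] = Im_a(c·(su2Quat P_{i,e}·p))`. [cite: arXiv220412737, §2 (2.4) (p. 10)] -/
theorem slice_anchored_frameDeriv (c : ℍ) (i : Fin (2 * L - 1 + 1)) (e : Edge 3 L) (p : ℍ)
    (P : (Fin (2 * L - 1 + 1) → GaugeConfig 3 L SU2) × (Site 3 L → SU2))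
    (ℓ : ((Fin (2 * L - 1 + 1) → Edge 3 L → Matrix (Fin 2) (Fin 2) ℂ) × (Site 3 L → Matrix (Fin 2) (Fin 2) ℂ)) →L[ℝ] ℝ) :
    ((∀ M, ℓ M = (c * ⟨((M.1 i e) 0 0).re, ((M.1 i e) 0 0).im, ((M.1 i e) 0 1).re, ((M.1 i e) 0 1).im⟩).imI) →
        fderiv ℝ ℓ (ringCoord L P) (sliceTangent i e (quatMatrix p) P) = (c * (su2Quat (P.1 i e) * p)).imI) ∧
    ((∀ M, ℓ M = (c * ⟨((M.1 i e) 0 0).re, ((M.1 i e) 0 0).im, ((M.1 i e) 0 1).re, ((M.1 i e) 0 1).im⟩).imJ) →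
        fderiv ℝ ℓ (ringCoord L P) (sliceTangent i e (quatMatrix p) P) = (c * (su2Quat (P.1 i e) * p)).imJ) ∧
    ((∀ M, ℓ M = (c * ⟨((M.1 i e) 0 0).re, ((M.1 i e) 0 0).im, ((M.1 i e) 0 1).re, ((M.1 i e) 0 1).im⟩).imK) →
        fderiv ℝ ℓ (ringCoord L P) (sliceTangent i e (quatMatrix p) P) = (c * (su2Quat (P.1 i e) * p)).imK) := by
  have htan : (sliceTangent i e (quatMatrix p) P).1 i e = quatMatrix (su2Quat (P.1 i e) * p) := by
    simp only [sliceTangent, sliceDir_self, coe_mul_quatMatrix]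
  refine ⟨fun hℓ => ?_, fun hℓ => ?_, fun hℓ => ?_⟩ <;>
  · rw [ℓ.fderiv, hℓ, htan, readQuat_quatMatrix]

/-- The anchored slice profile of `(i,e)` is transparent to the frame directions of every OTHER slice variable. [folklore] -/
theorem slice_anchored_frameDeriv_of_ne (c : ℍ) {i i' : Fin (2 * L - 1 + 1)} {e e' : Edge 3 L} (h : ¬(i = i' ∧ e = e'))
    (Y : Matrix (Fin 2) (Fin 2) ℂ) (P : (Fin (2 * L - 1 + 1) → GaugeConfig 3 L SU2) × (Site 3 L → SU2))
    (ℓ : ((Fin (2 * L - 1 + 1) → Edge 3 L → Matrix (Fin 2) (Fin 2) ℂ) × (Site 3 L → Matrix (Fin 2) (Fin 2) ℂ)) →L[ℝ] ℝ)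
    (hℓ : (∀ M, ℓ M = (c * ⟨((M.1 i e) 0 0).re, ((M.1 i e) 0 0).im, ((M.1 i e) 0 1).re, ((M.1 i e) 0 1).im⟩).imI) ∨
      (∀ M, ℓ M = (c * ⟨((M.1 i e) 0 0).re, ((M.1 i e) 0 0).im, ((M.1 i e) 0 1).re, ((M.1 i e) 0 1).im⟩).imJ) ∨
      (∀ M, ℓ M = (c * ⟨((M.1 i e) 0 0).re, ((M.1 i e) 0 0).im, ((M.1 i e) 0 1).re, ((M.1 i e) 0 1).im⟩).imK)) :
    fderiv ℝ ℓ (ringCoord L P) (sliceTangent i' e' Y P) = 0 := by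
  have htan : (sliceTangent i' e' Y P).1 i e = 0 := by
    simp only [sliceTangent, sliceDir_of_ne Y h, Matrix.mul_zero]
  rcases hℓ with hℓ | hℓ | hℓ <;>
  · rw [ℓ.fderiv, hℓ, htan, readQuat_zero]; simp

/-- The anchored slice profile is transparent to every seam direction. [folklore] -/
theorem slice_anchored_frameDeriv_seam (c : ℍ) (i : Fin (2 * L - 1 + 1)) (e : Edge 3 L) (x : Site 3 L) (Y : Matrix (Fin 2) (Fin 2) ℂ)
    (P : (Fin (2 * L - 1 + 1) → GaugeConfig 3 L SU2) × (Site 3 L → SU2))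
    (ℓ : ((Fin (2 * L - 1 + 1) → Edge 3 L → Matrix (Fin 2) (Fin 2) ℂ) × (Site 3 L → Matrix (Fin 2) (Fin 2) ℂ)) →L[ℝ] ℝ)
    (hℓ : (∀ M, ℓ M = (c * ⟨((M.1 i e) 0 0).re, ((M.1 i e) 0 0).im, ((M.1 i e) 0 1).re, ((M.1 i e) 0 1).im⟩).imI) ∨
      (∀ M, ℓ M = (c * ⟨((M.1 i e) 0 0).re, ((M.1 i e) 0 0).im, ((M.1 i e) 0 1).re, ((M.1 i e) 0 1).im⟩).imJ) ∨
      (∀ M, ℓ M = (c * ⟨((M.1 i e) 0 0).re, ((M.1 i e) 0 0).im, ((M.1 i e) 0 1).re, ((M.1 i e) 0 1).im⟩).imK)) :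
    fderiv ℝ ℓ (ringCoord L P) (seamTangent x Y P) = 0 := by
  have htan : (seamTangent x Y P).1 i e = 0 := rfl
  rcases hℓ with hℓ | hℓ | hℓ <;>
  · rw [ℓ.fderiv, hℓ, htan, readQuat_zero]; simp

/-- ★★ **Frame derivative of the anchored seam profile along its own variable.** [cite: arXiv220412737, §2 (2.4) (p. 10)] -/
theorem seam_anchored_frameDeriv (c : ℍ) (x : Site 3 L) (p : ℍ)
    (P : (Fin (2 * L - 1 + 1) → GaugeConfig 3 L SU2) × (Site 3 L → SU2))
    (ℓ : ((Fin (2 * L - 1 + 1) → Edge 3 L → Matrix (Fin 2) (Fin 2) ℂ) × (Site 3 L → Matrix (Fin 2) (Fin 2) ℂ)) →L[ℝ] ℝ) :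
    ((∀ M, ℓ M = (c * ⟨((M.2 x) 0 0).re, ((M.2 x) 0 0).im, ((M.2 x) 0 1).re, ((M.2 x) 0 1).im⟩).imI) →
        fderiv ℝ ℓ (ringCoord L P) (seamTangent x (quatMatrix p) P) = (c * (su2Quat (P.2 x) * p)).imI) ∧
    ((∀ M, ℓ M = (c * ⟨((M.2 x) 0 0).re, ((M.2 x) 0 0).im, ((M.2 x) 0 1).re, ((M.2 x) 0 1).im⟩).imJ) →
        fderiv ℝ ℓ (ringCoord L P) (seamTangent x (quatMatrix p) P) = (c * (su2Quat (P.2 x) * p)).imJ) ∧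
    ((∀ M, ℓ M = (c * ⟨((M.2 x) 0 0).re, ((M.2 x) 0 0).im, ((M.2 x) 0 1).re, ((M.2 x) 0 1).im⟩).imK) →
        fderiv ℝ ℓ (ringCoord L P) (seamTangent x (quatMatrix p) P) = (c * (su2Quat (P.2 x) * p)).imK) := by
  have htan : (seamTangent x (quatMatrix p) P).2 x = quatMatrix (su2Quat (P.2 x) * p) := by
    simp only [seamTangent, seamDir_self, coe_mul_quatMatrix]
  refine ⟨fun hℓ => ?_, fun hℓ => ?_, fun hℓ => ?_⟩ <;>
  · rw [ℓ.fderiv, hℓ, htan, readQuat_quatMatrix]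

/-- The anchored seam profile is transparent to the other seam variables and to every slice direction. [folklore] -/
theorem seam_anchored_frameDeriv_of_ne (c : ℍ) (x : Site 3 L) (P : (Fin (2 * L - 1 + 1) → GaugeConfig 3 L SU2) × (Site 3 L → SU2))
    (ℓ : ((Fin (2 * L - 1 + 1) → Edge 3 L → Matrix (Fin 2) (Fin 2) ℂ) × (Site 3 L → Matrix (Fin 2) (Fin 2) ℂ)) →L[ℝ] ℝ)
    (hℓ : (∀ M, ℓ M = (c * ⟨((M.2 x) 0 0).re, ((M.2 x) 0 0).im, ((M.2 x) 0 1).re, ((M.2 x) 0 1).im⟩).imI) ∨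
      (∀ M, ℓ M = (c * ⟨((M.2 x) 0 0).re, ((M.2 x) 0 0).im, ((M.2 x) 0 1).re, ((M.2 x) 0 1).im⟩).imJ) ∨
      (∀ M, ℓ M = (c * ⟨((M.2 x) 0 0).re, ((M.2 x) 0 0).im, ((M.2 x) 0 1).re, ((M.2 x) 0 1).im⟩).imK))
    (Y : Matrix (Fin 2) (Fin 2) ℂ) :
    (∀ x' : Site 3 L, x ≠ x' → fderiv ℝ ℓ (ringCoord L P) (seamTangent x' Y P) = 0) ∧
    (∀ (i : Fin (2 * L - 1 + 1)) (e : Edge 3 L), fderiv ℝ ℓ (ringCoord L P) (sliceTangent i e Y P) = 0) := by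
  refine ⟨fun x' hx => ?_, fun i e => ?_⟩
  · have htan : (seamTangent x' Y P).2 x = 0 := by
      simp only [seamTangent, seamDir_of_ne Y hx, Matrix.mul_zero]
    rcases hℓ with hℓ | hℓ | hℓ <;>
    · rw [ℓ.fderiv, hℓ, htan, readQuat_zero]; simp
  · have htan : (sliceTangent i e Y P).2 x = 0 := rfl
    rcases hℓ with hℓ | hℓ | hℓ <;>
    · rw [ℓ.fderiv, hℓ, htan, readQuat_zero]; simp

/-! ## §4 The exact per-variable divergence of the anchored profile -/

/-- ★★★ **The exact per-variable divergence of the ANCHORED profile (slice variable)**: with the three anchored functionals `ℓ₁, ℓ₂, ℓ₃` of `(i,e)`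
(anchor `c` frozen) and the three unit directions `quatMatrix i ∕ j ∕ k`:  `Dℓ₁[tangent_i] + Dℓ₂[tangent_j] + Dℓ₃[tangent_k] = 3·Re(c·su2Quat P_{i,e})` —
the transverse field `U` of the explicit central field has Haar divergence `3·Re(conj(c_v)·q(P_v)) ≤ 3` per variable. [cite: arXiv220412737, §2 (2.4) (p. 10)] -/
theorem slice_anchored_div (c : ℍ) (i : Fin (2 * L - 1 + 1)) (e : Edge 3 L) (P : (Fin (2 * L - 1 + 1) → GaugeConfig 3 L SU2) × (Site 3 L → SU2))
    (ℓ₁ ℓ₂ ℓ₃ : ((Fin (2 * L - 1 + 1) → Edge 3 L → Matrix (Fin 2) (Fin 2) ℂ) × (Site 3 L → Matrix (Fin 2) (Fin 2) ℂ)) →L[ℝ] ℝ)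
    (h₁ : ∀ M, ℓ₁ M = (c * ⟨((M.1 i e) 0 0).re, ((M.1 i e) 0 0).im, ((M.1 i e) 0 1).re, ((M.1 i e) 0 1).im⟩).imI)
    (h₂ : ∀ M, ℓ₂ M = (c * ⟨((M.1 i e) 0 0).re, ((M.1 i e) 0 0).im, ((M.1 i e) 0 1).re, ((M.1 i e) 0 1).im⟩).imJ)
    (h₃ : ∀ M, ℓ₃ M = (c * ⟨((M.1 i e) 0 0).re, ((M.1 i e) 0 0).im, ((M.1 i e) 0 1).re, ((M.1 i e) 0 1).im⟩).imK) :
    fderiv ℝ ℓ₁ (ringCoord L P) (sliceTangent i e (quatMatrix ⟨0, 1, 0, 0⟩) P) +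
      fderiv ℝ ℓ₂ (ringCoord L P) (sliceTangent i e (quatMatrix ⟨0, 0, 1, 0⟩) P) +
      fderiv ℝ ℓ₃ (ringCoord L P) (sliceTangent i e (quatMatrix ⟨0, 0, 0, 1⟩) P) = 3 * (c * su2Quat (P.1 i e)).re := by
  rw [(slice_anchored_frameDeriv c i e _ P ℓ₁).1 h₁, (slice_anchored_frameDeriv c i e _ P ℓ₂).2.1 h₂, (slice_anchored_frameDeriv c i e _ P ℓ₃).2.2 h₃]
  exact anchored_units_sum _ _

/-- ★★★ **The exact per-variable divergence of the ANCHORED profile (seam variable).** [cite: arXiv220412737, §2 (2.4) (p. 10)] -/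
theorem seam_anchored_div (c : ℍ) (x : Site 3 L) (P : (Fin (2 * L - 1 + 1) → GaugeConfig 3 L SU2) × (Site 3 L → SU2))
    (ℓ₁ ℓ₂ ℓ₃ : ((Fin (2 * L - 1 + 1) → Edge 3 L → Matrix (Fin 2) (Fin 2) ℂ) × (Site 3 L → Matrix (Fin 2) (Fin 2) ℂ)) →L[ℝ] ℝ)
    (h₁ : ∀ M, ℓ₁ M = (c * ⟨((M.2 x) 0 0).re, ((M.2 x) 0 0).im, ((M.2 x) 0 1).re, ((M.2 x) 0 1).im⟩).imI)
    (h₂ : ∀ M, ℓ₂ M = (c * ⟨((M.2 x) 0 0).re, ((M.2 x) 0 0).im, ((M.2 x) 0 1).re, ((M.2 x) 0 1).im⟩).imJ)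
    (h₃ : ∀ M, ℓ₃ M = (c * ⟨((M.2 x) 0 0).re, ((M.2 x) 0 0).im, ((M.2 x) 0 1).re, ((M.2 x) 0 1).im⟩).imK) :
    fderiv ℝ ℓ₁ (ringCoord L P) (seamTangent x (quatMatrix ⟨0, 1, 0, 0⟩) P) +
      fderiv ℝ ℓ₂ (ringCoord L P) (seamTangent x (quatMatrix ⟨0, 0, 1, 0⟩) P) +
      fderiv ℝ ℓ₃ (ringCoord L P) (seamTangent x (quatMatrix ⟨0, 0, 0, 1⟩) P) = 3 * (c * su2Quat (P.2 x)).re := by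
  rw [(seam_anchored_frameDeriv c x _ P ℓ₁).1 h₁, (seam_anchored_frameDeriv c x _ P ℓ₂).2.1 h₂, (seam_anchored_frameDeriv c x _ P ℓ₃).2.2 h₃]
  exact anchored_units_sum _ _

section Bounds

omit [NeZero L]

/-- ★ For a UNIT anchor the per-variable divergence of the anchored profile is at most `3`. [folklore] -/
theorem anchored_div_le {c : ℍ} (hc : ‖c‖ = 1) (U : SU2) : 3 * (c * su2Quat U).re ≤ 3 := by
  have h := (re_mul_le_of_norm hc (norm_su2Quat U)).2
  linarith

/-- … and at most `3` in absolute value. [folklore] -/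
theorem abs_anchored_div_le {c : ℍ} (hc : ‖c‖ = 1) (U : SU2) : |3 * (c * su2Quat U).re| ≤ 3 := by
  rw [abs_mul, abs_of_pos (by norm_num : (0 : ℝ) < 3)]
  have h := (re_mul_le_of_norm hc (norm_su2Quat U)).1
  linarith

/-- ★ The anchors of the explicit central field are unit: for the conjugate central lift `c = conj(liftQuat σ z)` (`σ² = 1`, `|z|² ≤ 1`) the per-variable
divergence of `U` is `≤ 3`. [cite: CosteEtAl1985] -/
theorem anchored_div_le_liftQuat {σ : ℝ} (hσ : σ ^ 2 = 1) {z : Fin 3 → ℝ} (hz : (z 0) ^ 2 + (z 1) ^ 2 + (z 2) ^ 2 ≤ 1) (U : SU2) :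
    3 * (star (liftQuat σ z) * su2Quat U).re ≤ 3 :=
  anchored_div_le (norm_star_liftQuat hσ hz) U

end Bounds

end Summit.QuantumFields.YangMills.Theorems.VirialFluxGap.FrameDerivative

end
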